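import Mathlib
import HarnessLib

/-!
# Pooled versus per-sector Kish effective sample size: `min_g ESS_g ≤ ESS_pooled ≤ Σ_g ESS_g`

HONEST FRAMING: exact (Metropolis-corrected) sampling algorithms for lattice gauge theory;
figures of merit are autocorrelation/cost numbers at stated couplings and volumes; no
continuum-physics claim.

Venture `LatticeQCDFlow` (cell pub-lqcd), sub-topic `Scoring`; FANOUT row 11 (`eng-scorerA`,
fitness scorer A: 'ESS (pooled AND per topological sector)', reweight cap rule).  NEW WORK of the
cell (elementary finite sums), not a published result; nothing is cited as a fact.

## Content

In reweight mode a scored run is a finite family of positive importance weights `wᵢ = exp(log_wᵢ)`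
on the pooled samples `i ∈ s`, and every sample carries a label `grp i` (its topological sector for
the per-sector ESS of FITNESS §1 / FITNESS-A §A3, or its stream for the per-stream bookkeeping).
The Kish effective sample size of a finite family is

  `kishESS s w = (∑_{i ∈ s} wᵢ)² / ∑_{i ∈ s} wᵢ²`                         (`kishESS`)

(the ABSOLUTE count; `Exactness.essHat` is the fraction `kishESS / n` on a `Fintype`).  Writing
`s_g = {i ∈ s | grp i = g}` for the fibres:

* `kishESS_le_card` — `kishESS s w ≤ #s` (Cauchy–Schwarz against the constant vector); this is
  why, in the frozen reweight cap `n_eff_used = min (n_eff_est, N, Kish)` (lead RA-28/29, one text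
  for scorers A and B), the member `N` never binds strictly below the pooled Kish value:
  `nEffUsed_eq_of_kish_le`, `min (min n N) K = min n K` whenever `K ≤ N`;
* `sq_sum_div_le_sum_groups` / `kishESS_le_sum_fibers` — **pooling never manufactures effective
  samples**: `kishESS s w ≤ ∑_g kishESS s_g w` (Sedrakyan's form of Cauchy–Schwarz on the group
  aggregates `A_g = ∑_{s_g} w`, `B_g = ∑_{s_g} w²`: `(∑ A_g)²/∑ B_g ≤ ∑ A_g²/B_g`);
* `le_pooled_of_forall_le_groups` / `le_kishESS_of_forall_le_fibers` — **pooling never reports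
  fewer effective samples than the worst group**: if every group has `m ≤ kishESS s_g w` then
  `m ≤ kishESS s w`.

Both bounds are attained (all mass in one sector: pooled `=` that sector's ESS while the other
sectors' ESS are arbitrary), so neither number determines the other — the reason FITNESS asks for
the pooled AND the per-sector figure, and the reason the cap uses the POOLED Kish value (the
smaller of 'pooled' and 'sum over sectors').
-/

namespace Summit.Ventures.LatticeQCDFlow.Scoring

open Finset

variable {ι κ : Type*}

/-- Kish effective sample size (absolute count) of the weights `w` on the finite family `s`:
`(∑ w)² / ∑ w²` (`0` by Lean's convention when `∑ w² = 0`). -/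
noncomputable def kishESS (s : Finset ι) (w : ι → ℝ) : ℝ :=
  (∑ i ∈ s, w i) ^ 2 / ∑ i ∈ s, w i ^ 2

/-- `0 ≤ kishESS`. -/
theorem kishESS_nonneg (s : Finset ι) (w : ι → ℝ) : 0 ≤ kishESS s w :=
  div_nonneg (sq_nonneg _) (sum_nonneg fun _ _ => sq_nonneg _)

/-- **Kish ≤ sample count**: `(∑ w)² / ∑ w² ≤ #s` (Cauchy–Schwarz against the constant vector). -/
theorem kishESS_le_card (s : Finset ι) (w : ι → ℝ) : kishESS s w ≤ (s.card : ℝ) := by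
  unfold kishESS
  rcases (sum_nonneg fun i (_ : i ∈ s) => sq_nonneg (w i)).eq_or_lt with h | h
  · rw [← h, div_zero]; exact Nat.cast_nonneg _
  · rw [div_le_iff₀ h]
    have hcs := Finset.sum_mul_sq_le_sq_mul_sq s w (fun _ => (1 : ℝ))
    simp only [mul_one, one_pow, sum_const, nsmul_eq_mul] at hcs
    calc (∑ i ∈ s, w i) ^ 2 ≤ (∑ i ∈ s, w i ^ 2) * (s.card : ℝ) := hcs
      _ = (s.card : ℝ) * ∑ i ∈ s, w i ^ 2 := mul_comm _ _

/-- A positive weight somewhere in `s` makes `∑_{s} w² > 0`. -/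
theorem sum_sq_pos_of_pos {s : Finset ι} {w : ι → ℝ} (hs : s.Nonempty) (hw : ∀ i ∈ s, 0 < w i) :
    0 < ∑ i ∈ s, w i ^ 2 :=
  sum_pos (fun i hi => pow_pos (hw i hi) 2) hs

/-! ### Upper bound: pooled ≤ sum over groups -/

/-- **Sedrakyan / Engel form of Cauchy–Schwarz on group aggregates.**  With per-group first and
second weight moments `A_g`, `B_g > 0`, the pooled Kish value is at most the sum of the per-group
ones: `(∑_g A_g)² / ∑_g B_g ≤ ∑_g A_g² / B_g`. -/
theorem sq_sum_div_le_sum_groups (G : Finset κ) (A B : κ → ℝ) (hB : ∀ g ∈ G, 0 < B g) :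
    (∑ g ∈ G, A g) ^ 2 / ∑ g ∈ G, B g ≤ ∑ g ∈ G, A g ^ 2 / B g :=
  Finset.sq_sum_div_le_sum_sq_div G A hB

/-- **Pooling never manufactures effective samples.**  For positive weights and any labelling
`grp` (sectors, streams), the pooled Kish ESS is at most the sum of the per-label Kish ESS over the
labels present: `kishESS s w ≤ ∑_{g ∈ grp '' s} kishESS {i ∈ s | grp i = g} w`. -/
theorem kishESS_le_sum_fibers [DecidableEq κ] (s : Finset ι) (w : ι → ℝ) (grp : ι → κ)
    (hw : ∀ i ∈ s, 0 < w i) :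
    kishESS s w ≤ ∑ g ∈ s.image grp, kishESS (s.filter fun i => grp i = g) w := by
  have hmaps : ∀ i ∈ s, grp i ∈ s.image grp := fun i hi => mem_image_of_mem grp hi
  have hA : ∑ i ∈ s, w i = ∑ g ∈ s.image grp, ∑ i ∈ s.filter (fun i => grp i = g), w i :=
    (sum_fiberwise_of_maps_to hmaps _).symm
  have hB : ∑ i ∈ s, w i ^ 2
      = ∑ g ∈ s.image grp, ∑ i ∈ s.filter (fun i => grp i = g), w i ^ 2 :=
    (sum_fiberwise_of_maps_to hmaps _).symm
  have hpos : ∀ g ∈ s.image grp, 0 < ∑ i ∈ s.filter (fun i => grp i = g), w i ^ 2 := by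
    intro g hg
    obtain ⟨i, hi, rfl⟩ := mem_image.mp hg
    exact sum_sq_pos_of_pos ⟨i, mem_filter.mpr ⟨hi, rfl⟩⟩
      (fun j hj => hw j (mem_filter.mp hj).1)
  unfold kishESS
  rw [hA, hB]
  exact sq_sum_div_le_sum_groups _ _ _ hpos

/-! ### Lower bound: pooled ≥ the worst group -/

/-- For non-negative terms, the sum of squares is at most the square of the sum. -/
theorem sum_sq_le_sq_sum_of_nonneg (G : Finset κ) (A : κ → ℝ) (hA : ∀ g ∈ G, 0 ≤ A g) :
    ∑ g ∈ G, A g ^ 2 ≤ (∑ g ∈ G, A g) ^ 2 := by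
  rw [sq, sum_mul_sum]
  refine sum_le_sum fun g hg => ?_
  rw [sq]
  calc A g * A g = ∑ h ∈ ({g} : Finset κ), A g * A h := by simp
    _ ≤ ∑ h ∈ G, A g * A h :=
        sum_le_sum_of_subset_of_nonneg (singleton_subset_iff.mpr hg)
          (fun h hh _ => mul_nonneg (hA g hg) (hA h hh))

/-- **Pooling never reports fewer effective samples than the worst group** (aggregate form): if
`m ≤ A_g² / B_g` for every group (`A_g ≥ 0`, `B_g > 0`, at least one group), then
`m ≤ (∑ A_g)² / ∑ B_g`. -/
theorem le_pooled_of_forall_le_groups (G : Finset κ) (A B : κ → ℝ) (m : ℝ) (hG : G.Nonempty)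
    (hA : ∀ g ∈ G, 0 ≤ A g) (hB : ∀ g ∈ G, 0 < B g) (hm : ∀ g ∈ G, m ≤ A g ^ 2 / B g) :
    m ≤ (∑ g ∈ G, A g) ^ 2 / ∑ g ∈ G, B g := by
  have hBpos : 0 < ∑ g ∈ G, B g := sum_pos hB hG
  rw [le_div_iff₀ hBpos, mul_sum]
  calc ∑ g ∈ G, m * B g ≤ ∑ g ∈ G, A g ^ 2 := by
        refine sum_le_sum fun g hg => ?_
        exact (le_div_iff₀ (hB g hg)).mp (hm g hg)
    _ ≤ (∑ g ∈ G, A g) ^ 2 := sum_sq_le_sq_sum_of_nonneg G A hA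

/-- **Pooled Kish ESS ≥ the smallest per-label Kish ESS.**  For positive weights on a non-empty
family: if every label present has `m ≤ kishESS {i ∈ s | grp i = g} w`, then `m ≤ kishESS s w`. -/
theorem le_kishESS_of_forall_le_fibers [DecidableEq κ] (s : Finset ι) (w : ι → ℝ) (grp : ι → κ)
    (m : ℝ) (hs : s.Nonempty) (hw : ∀ i ∈ s, 0 < w i)
    (hm : ∀ g ∈ s.image grp, m ≤ kishESS (s.filter fun i => grp i = g) w) :
    m ≤ kishESS s w := by
  have hmaps : ∀ i ∈ s, grp i ∈ s.image grp := fun i hi => mem_image_of_mem grp hi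
  have hA : ∑ i ∈ s, w i = ∑ g ∈ s.image grp, ∑ i ∈ s.filter (fun i => grp i = g), w i :=
    (sum_fiberwise_of_maps_to hmaps _).symm
  have hB : ∑ i ∈ s, w i ^ 2
      = ∑ g ∈ s.image grp, ∑ i ∈ s.filter (fun i => grp i = g), w i ^ 2 :=
    (sum_fiberwise_of_maps_to hmaps _).symm
  unfold kishESS at hm ⊢
  rw [hA, hB]
  refine le_pooled_of_forall_le_groups _ _ _ m (hs.image grp) ?_ ?_ hm
  · intro g _
    exact sum_nonneg fun j hj => (hw j (mem_filter.mp hj).1).le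
  · intro g hg
    obtain ⟨i, hi, rfl⟩ := mem_image.mp hg
    exact sum_sq_pos_of_pos ⟨i, mem_filter.mpr ⟨hi, rfl⟩⟩
      (fun j hj => hw j (mem_filter.mp hj).1)

/-! ### The reweight cap `n_eff_used = min (n_eff_est, N, Kish)` -/

/-- The frozen reweight-mode cap of both scorers (lead RA-28/29): per observable,
`n_eff_used = min (n_eff_est, N_pooled, pooled Kish ESS)`. -/
noncomputable def nEffUsed (nEst N K : ℝ) : ℝ :=
  min (min nEst N) K

/-- `n_eff_used ≤` each of its three members. -/
theorem nEffUsed_le (nEst N K : ℝ) :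
    nEffUsed nEst N K ≤ nEst ∧ nEffUsed nEst N K ≤ N ∧ nEffUsed nEst N K ≤ K :=
  ⟨(min_le_left _ _).trans (min_le_left _ _), (min_le_left _ _).trans (min_le_right _ _),
    min_le_right _ _⟩

/-- Since the pooled Kish ESS never exceeds the pooled count (`kishESS_le_card`), the `N` member
of the cap is redundant as a VALUE: `K ≤ N ⟹ min (min n N) K = min n K` (it survives only as the
informational label `n_eff_capped_by = N` in the tie `K = N`, i.e. constant weights). -/
theorem nEffUsed_eq_of_kish_le {nEst N K : ℝ} (hKN : K ≤ N) : nEffUsed nEst N K = min nEst K := by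
  unfold nEffUsed
  rcases le_total nEst N with h | h
  · rw [min_eq_left h]
  · rw [min_eq_right h, min_eq_right hKN, min_eq_right (hKN.trans h)]

/-- The cap instantiated on a scored family: with `K = kishESS s w` and `N = #s` the hypothesis of
`nEffUsed_eq_of_kish_le` holds, so `n_eff_used = min (n_eff_est, Kish)`. -/
theorem nEffUsed_card_kishESS (s : Finset ι) (w : ι → ℝ) (nEst : ℝ) :
    nEffUsed nEst (s.card : ℝ) (kishESS s w) = min nEst (kishESS s w) :=
  nEffUsed_eq_of_kish_le (kishESS_le_card s w)

end Summit.Ventures.LatticeQCDFlow.Scoring
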